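import Summits.KontsevichZagierPeriods.KontsevichZagierPeriods.Theses.UnfoldedStokes
import Literature.NumberTheory.Transcendental.KZLogCalculusProofs
import Literature.ModelTheory.ExponentialFields.SemialgebraicDimension
import Literature.ModelTheory.ExponentialFields.SemialgebraicFlatReparam

/-!
# Crux-ideate r1 (ideator k = 3): first lemmas for `ContinuousCubification` (stmt-KontsevichZagierPeriods-17853)

Typed first lemmas (statements only, as `Prop`s — no skeleton at this stage) of the two idea cards

* `korobov-damping-cubification` : `KorobovDamping`, `KorobovMove`, `OpenCellFlattening`,
  `DampingLine`;
* `virtual-root-node-damping`   : `VirtualRootsGLM`, `NodeDampingChart`.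

Everything is stated over existing declarations (`KZ.IntegralRep`, `KZ.relations`,
`KZ.changeOfVariablesRel`, `IsSACell`, `smoothstep`, `frOmega`/`frOmegaD`, `ContinuousCubification`).
-/

noncomputable section

set_option linter.dupNamespace false

namespace Summit.KontsevichZagierPeriods.KontsevichZagierPeriods.Cruxes.ContinuousCubification.IdeateR1K3

open MeasureTheory Set
open Literature.NumberTheory.Transcendental
open Literature.NumberTheory.Transcendental.KZ
open Literature.ModelTheory.ExponentialFields (IsSemialgebraic IsSACell smoothstep frOmega frOmegaD frNode)
open Summit.KontsevichZagierPeriods.KontsevichZagierPeriods.Theses.UnfoldedStokes (ContinuousCubification)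

/-- The open unit cube `(0,1)^M`. -/
abbrev openCube (M : ℕ) : Set (Fin M → ℝ) := Set.pi Set.univ (fun _ : Fin M => Set.Ioo (0:ℝ) 1)

/-- The closed unit cube `[0,1]^M` (literally the domain shape of the crux). -/
abbrev closedCube (M : ℕ) : Set (Fin M → ℝ) := Set.pi Set.univ (fun _ : Fin M => Set.Icc (0:ℝ) 1)

/-- Korobov's coordinatewise cubic periodizer `P(t)_i = 3 t_i² − 2 t_i³` (= the tree's `smoothstep`
on `[0,1]`), a polynomial bijection of the closed cube fixing its faces, whose Jacobian
`∏ 6 tᵢ (1 − tᵢ)` vanishes exactly on the boundary. -/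
def korobov (M : ℕ) (t : Fin M → ℝ) : Fin M → ℝ := fun i => smoothstep (t i)

/-- Its Jacobian determinant on the cube. -/
def korobovJac (M : ℕ) (t : Fin M → ℝ) : ℝ := ∏ i : Fin M, 6 * t i * (1 - t i)

/-! ## Card `korobov-damping-cubification` -/

/-- FIRST LEMMA (A1, the lever): **Korobov damping.** A representation on the OPEN unit cube whose
integrand is continuous there and bounded is congruent modulo the moves to a representation on the
CLOSED unit cube whose integrand is continuous on the closed cube — namely
`t ↦ h(P t) · ∏ 6tᵢ(1−tᵢ)` extended by `0` (one rule-(2) move along `P = korobov`, then a null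
boundary). -/
def KorobovDamping : Prop :=
  ∀ (M : ℕ) (r : IntegralRep M), r.domain = openCube M → ContinuousOn r.integrand r.domain →
    (∃ B : ℝ, ∀ x ∈ r.domain, |r.integrand x| ≤ B) →
    ∃ t : IntegralRep M, t.domain = closedCube M ∧ ContinuousOn t.integrand t.domain ∧
      EqOn t.integrand (fun u => r.integrand (korobov M u) * korobovJac M u) (openCube M) ∧
      (∀ u ∈ closedCube M \ openCube M, t.integrand u = 0) ∧
      of r - of t ∈ relations

/-- A1 at move level: the damping step is ONE instance of rule (2) (playbook witness
`⟨M, r', r, korobov, korobov', semialg, fderiv, injOn, image, jacobian, rfl⟩`). -/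
def KorobovMove : Prop :=
  ∀ (M : ℕ) (r r' : IntegralRep M), r.domain = openCube M → r'.domain = openCube M →
    (∀ u ∈ openCube M, r'.integrand u = r.integrand (korobov M u) * korobovJac M u) →
    of r' - of r ∈ changeOfVariablesRel

/-- FIRST LEMMA (A2): **triangular flattening of an open `ℚ`-CAD cell.** A bounded open cell
(`IsSACell ℚ N N C`: bands over bands, continuous `ℚ`-semialgebraic sections) carrying a bounded
integrand continuous on the cell is congruent modulo the moves to a representation on the open cube
with bounded integrand continuous on the open cube: the flattening
`x_i = φ_i(x_{<i}) + t_i (ψ_i − φ_i)(x_{<i})` is a homeomorphism, `C¹` on a co-null open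
`ℚ`-semialgebraic set (generic smoothness of the sections), lower-triangular there with
`det = ∏ (ψ_i − φ_i)(x_{<i}(t))` — a product of fibre lengths, bounded and continuous on the WHOLE
open cube with no control on the derivatives of the sections. -/
def OpenCellFlattening : Prop :=
  ∀ (N : ℕ) (C : Set (Fin N → ℝ)), IsSACell ℚ N N C → Bornology.IsBounded C →
    ∀ (r : IntegralRep N), r.domain = C → ContinuousOn r.integrand C →
      (∃ B : ℝ, ∀ x ∈ C, |r.integrand x| ≤ B) →
      ∃ r' : IntegralRep N, r'.domain = openCube N ∧ ContinuousOn r'.integrand r'.domain ∧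
        (∃ B' : ℝ, ∀ u ∈ r'.domain, |r'.integrand u| ≤ B') ∧ of r - of r' ∈ relations

/-- The line's shape (to become the composition of a crux-plan skeleton): bounded cube normal form
(`stub_cubifyKernel`, landed) → smooth locus + `ℚ`-CAD adapted to it (landed) → A2 per open cell →
A1 → merge by rule (1b). -/
def DampingLine : Prop := KorobovDamping → OpenCellFlattening → ContinuousCubification

/-! ## Card `virtual-root-node-damping` -/

/-- Coefficient vector ↦ monic polynomial `X^d + Σ_{i<d} a_i X^i`. -/
def monicOf (d : ℕ) (a : Fin d → ℝ) : Polynomial ℝ :=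
  Polynomial.X ^ d + ∑ i : Fin d, Polynomial.C (a i) * Polynomial.X ^ (i : ℕ)

/-- FIRST LEMMA (E1, a printed theorem to vendor/prove): **virtual roots** (Gonzalez-Vega–Lombardi–Mahé
1998, Def. 2.1, Prop. 2.2–2.3): on the space `ℝ^d` of monic degree-`d` polynomials there are `d`
CONTINUOUS, `ℚ`-semialgebraic functions `ρ₁ ≤ ⋯ ≤ ρ_d` such that every real root of `P` is some
`ρ_j(P)` (hence `P` has constant sign on each open gap `(ρ_j, ρ_{j+1})`). -/
def VirtualRootsGLM : Prop :=
  ∀ d : ℕ, ∃ ρ : Fin d → (Fin d → ℝ) → ℝ,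
    (∀ j, Continuous (ρ j)) ∧ (∀ j, IsSemialgebraicFunOn ℚ Set.univ (ρ j)) ∧
    (∀ a, Monotone fun j => ρ j a) ∧
    ∀ (a : Fin d → ℝ) (x : ℝ), (monicOf d a).eval x = 0 → ∃ j, ρ j a = x

/-- FIRST LEMMA (E2, the lever at move level): **fibrewise node damping over a box.** Over the closed
base cube let `y 0 ≤ ⋯ ≤ y r` be node functions, continuous on the closed base and `ℚ`-semialgebraic,
with `y 0 = 0`, `y r = 1`; let `h` be bounded, `ℚ`-semialgebraic, vanishing near the lateral
boundary, and continuous off the node graphs. Then `[closedCube (n+1), h]` is congruent modulo the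
moves to a closed-cube representation with CONTINUOUS integrand — namely
`(x', σ) ↦ h(x', ω_{x'}(κ(x') σ)) · κ(x') ω'_{x'}(κ(x') σ)` with Pawłucki's parametric smoothing
homeomorphism `ω = frOmega (y · x')`, whose `σ`-derivative vanishes at every node. -/
def NodeDampingChart : Prop :=
  ∀ (n r : ℕ) (y : ℕ → (Fin n → ℝ) → ℝ) (h : (Fin (n + 1) → ℝ) → ℝ),
    (∀ i, ContinuousOn (y i) (closedCube n)) → (∀ i, IsSemialgebraicFunOn ℚ (closedCube n) (y i)) →
    (∀ x' ∈ closedCube n, Monotone fun i => y i x') →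
    (∀ x' ∈ closedCube n, y 0 x' = 0 ∧ y r x' = 1) →
    IsSemialgebraicFunOn ℚ (closedCube (n + 1)) h →
    (∃ B : ℝ, ∀ z ∈ closedCube (n + 1), |h z| ≤ B) →
    (∃ δ > 0, ∀ z ∈ closedCube (n + 1), (∃ i, Fin.init z i ≤ δ ∨ 1 - δ ≤ Fin.init z i) → h z = 0) →
    ContinuousOn h {z | z ∈ closedCube (n + 1) ∧ ∀ i ≤ r, z (Fin.last n) ≠ y i (Fin.init z)} →
    ∃ t : IntegralRep (n + 1), t.domain = closedCube (n + 1) ∧ ContinuousOn t.integrand t.domain ∧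
      EqOn t.integrand
        (fun w => h (Fin.snoc (Fin.init w)
            (frOmega (fun i => y i (Fin.init w)) r (frNode (fun i => y i (Fin.init w)) r * w (Fin.last n)))) *
          (frNode (fun i => y i (Fin.init w)) r *
            frOmegaD (fun i => y i (Fin.init w)) r (frNode (fun i => y i (Fin.init w)) r * w (Fin.last n))))
        t.domain ∧
      ∀ s : IntegralRep (n + 1), s.domain = closedCube (n + 1) → EqOn s.integrand h s.domain →
        of s - of t ∈ relations

/-! ## Sanity checks that the constants exist and the statements are about the crux -/

example : Prop := ContinuousCubification
example (t : ℝ) : deriv smoothstep t = 6 * Literature.ModelTheory.ExponentialFields.stepClamp t *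
    (1 - Literature.ModelTheory.ExponentialFields.stepClamp t) :=
  Literature.ModelTheory.ExponentialFields.deriv_smoothstep t
example (y : ℕ → ℝ) (r i : ℕ) : frOmegaD y r (frNode y i) = 0 :=
  Literature.ModelTheory.ExponentialFields.frOmegaD_node r i

end Summit.KontsevichZagierPeriods.KontsevichZagierPeriods.Cruxes.ContinuousCubification.IdeateR1K3

end
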